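import Summits.SmoothPoincare4.SmoothPoincare4.Theorems.SymplecticOrigamiGromovRecognitionRelEndGlueData
import Summits.SmoothPoincare4.SmoothPoincare4.Theorems.SymplecticOrigamiGromovRecognitionRelEndClassCount
import Summits.SmoothPoincare4.SmoothPoincare4.Theorems.SymplecticOrigamiGromovRecognitionRelEndHolCoordCompJHol
import Literature.Geometry.Symplectic.JCurveIntersectionCountHomological
import Mathlib.Analysis.Complex.RealDeriv
import Mathlib.Geometry.Manifold.MFDeriv.SpecificFunctions

/-!
# The reference sphere meets every `H`-leaf in exactly one point, transversally
(registered helper `helper_refMeetsHLeafOnce` of line `cross-cap-laurent`, crux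
`GromovRecognitionRelEnd`, item stmt-SmoothPoincare4-11009; integration lemma J16 of the glue of
the bi-foliation)

Setting: the data `D : FoliationData ωX JX u₀ v₀ uH vH F₀ TH TV UH UV δ` of the `V`-fibration of
the wedge cap (reference sphere `V∞ = (u₀, v₀)`, holomorphic wedge coordinate `TV` on `UV` with
zero set `{y ∈ UV | TV y = 0} = V∞`) AND the data
`D' : FoliationData ωX JX uH vH u₀ v₀ FH TV TH UV UH δ` of the `H`-fibration (reference sphere
`H∞ = (uH, vH)` with glued map `FH`; its transverse coordinate slot holds `TV` on `UV`).  An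
`H`-leaf is `IsLeafOf (fun y => JX y) FH u' v'`.

Claim: `V∞` meets every `H`-leaf `(u', v')` in exactly one point `q`, and transversally: a tangent
vector `ξ` at `q` which is tangent to `V∞` (in the image of `du₀` at a parameter over `q`, or of
`dv₀ (0)` if `q = v₀ 0`) and tangent to the `H`-leaf vanishes.

Proof: `helper_leaf_meetsOnce` for `D'` (with the fact `jSphere_wedgeCount_factorsThroughHomology`,
a hypothesis): the `H`-leaf meets the zero set `{y ∈ UV | TV y = 0} = V∞` at exactly one
parameter, simply — either at a unique affine `z₀` with `deriv (TV ∘ u') z₀ ≠ 0` and not at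
`v' 0`, or nowhere in the affine chart and at `v' 0` with `deriv (TV ∘ v') 0 ≠ 0`.  Take
`q = u' z₀` (resp. `q = v' 0`); uniqueness of the meeting point is the uniqueness clause (and
`v' 0 ∉ range u'` for an embedded pair).  Transversality: `TV ∘ u₀` and `TV ∘ v₀` vanish
identically (`v₀ w = u₀ w⁻¹`), so by the chain rule `dTV_q` kills every vector tangent to `V∞`;
on the other hand for `ξ = du' (z₀) ζ` the chain rule gives `dTV_q ξ = d(TV ∘ u')_{z₀} ζ
= deriv (TV ∘ u') z₀ · ζ` (`TV ∘ u'` is complex differentiable, `helper_holCoordCompJHol`), so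
`ζ = 0` and `ξ = 0`; the same at `v' 0` in the second case.

References: M. Gromov, Invent. Math. 82 (1985), §2.4; D. McDuff, J. Amer. Math. Soc. 3 (1990),
§3 (the two transverse foliations of the cap); C. Wendl, *Holomorphic Curves in Low Dimensions*
(2018), §2.2.2.  No new definitions, notation or instances.
-/

noncomputable section

open scoped Manifold ContDiff Topology
open Set Function Filter Literature.Topology.FourManifolds Literature.Topology.FourManifolds.ComplexProjectiveSpace
  Literature.Geometry.Kaehler Literature.Geometry.Symplectic Literature.AlgebraicTopology.SingularHomology

-- the prescribed namespace `Summit.<P>.<Sub>.…` duplicates `SmoothPoincare4` (P = Sub)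
set_option linter.dupNamespace false

namespace Summit.SmoothPoincare4.SmoothPoincare4.Theorems.GromovRecognitionRelEnd.CrossCapLaurent

/-! ### Two chain-rule computations -/

/-- **Vectors tangent to a curve inside the zero set of `T` are killed by `dT`.**  If `T` is
smooth on the open `U` and the smooth `u : ℂ → X` takes values in `{y ∈ U | T y = 0}`, then
`dT_{u w} (du_w η) = 0`: by the chain rule this is `d(T ∘ u)_w η`, and `T ∘ u` is the zero
function. -/
theorem refMeet_mfderiv_apply_eq_zero {X : Type} [TopologicalSpace X]
    [ChartedSpace (EuclideanSpace ℝ (Fin 4)) X] [IsManifold (𝓡 4) ∞ X] {T : X → ℂ} {U : Set X}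
    (hU : IsOpen U) (hT : ContMDiffOn (𝓡 4) 𝓘(ℝ, ℂ) ∞ T U) {u : ℂ → X}
    (hu : ContMDiff 𝓘(ℝ, ℂ) (𝓡 4) ∞ u) (hzero : ∀ w : ℂ, u w ∈ U ∧ T (u w) = 0) (w η : ℂ) :
    mfderiv (𝓡 4) 𝓘(ℝ, ℂ) T (u w) (mfderiv 𝓘(ℝ, ℂ) (𝓡 4) u w η) = 0 := by
  have hTz : MDifferentiableAt (𝓡 4) 𝓘(ℝ, ℂ) T (u w) :=
    (hT.contMDiffAt (hU.mem_nhds (hzero w).1)).mdifferentiableAt (by simp)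
  have huz : MDifferentiableAt 𝓘(ℝ, ℂ) (𝓡 4) u w := hu.mdifferentiableAt (by simp)
  have hcomp : mfderiv 𝓘(ℝ, ℂ) 𝓘(ℝ, ℂ) (T ∘ u) w =
      (mfderiv (𝓡 4) 𝓘(ℝ, ℂ) T (u w)).comp (mfderiv 𝓘(ℝ, ℂ) (𝓡 4) u w) := mfderiv_comp w hTz huz
  have hconst : T ∘ u = fun _ => (0 : ℂ) := funext fun w => (hzero w).2
  have h0 : mfderiv 𝓘(ℝ, ℂ) 𝓘(ℝ, ℂ) (T ∘ u) w = 0 := by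
    rw [hconst]
    exact mfderiv_const
  exact DFunLike.congr_fun (hcomp.symm.trans h0) η

/-- **At a simple meeting point, `dT ∘ du` is injective.**  For a holomorphic coordinate `T` on
`U` and a smooth `J`-holomorphic `u : ℂ → X` with `u z₀ ∈ U` and `deriv (T ∘ u) z₀ ≠ 0`: if
`dT_{u z₀} (du_{z₀} ζ) = 0` then `ζ = 0`.  Indeed `T ∘ u` is complex differentiable at `z₀`
(`helper_holCoordCompJHol`), so its real differential `dT_{u z₀} ∘ du_{z₀}` (chain rule) is
`ζ ↦ ζ · deriv (T ∘ u) z₀`. -/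
theorem refMeet_eq_zero_of_deriv_ne_zero {X : Type} [TopologicalSpace X]
    [ChartedSpace (EuclideanSpace ℝ (Fin 4)) X] [IsManifold (𝓡 4) ∞ X]
    {JX : ∀ y : X, TangentSpace (𝓡 4) y →L[ℝ] TangentSpace (𝓡 4) y} {T : X → ℂ} {U : Set X}
    (hT : IsHolCoordinate JX T U) {u : ℂ → X} (hu : ContMDiff 𝓘(ℝ, ℂ) (𝓡 4) ∞ u)
    (hJu : IsJHolomorphic (𝓡 4) JX u) {z₀ : ℂ} (hz₀ : u z₀ ∈ U) (hd : deriv (T ∘ u) z₀ ≠ 0)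
    {ζ : ℂ} (hζ : mfderiv (𝓡 4) 𝓘(ℝ, ℂ) T (u z₀) (mfderiv 𝓘(ℝ, ℂ) (𝓡 4) u z₀ ζ) = 0) :
    ζ = 0 := by
  -- adapted from `CaseALeaf.injective_mfderiv_of_deriv_comp_ne_zero`
  -- `T ∘ u` is complex differentiable at `z₀`
  have hdiff : DifferentiableAt ℂ (T ∘ u) z₀ :=
    (helper_holCoordCompJHol X JX T U u hT.isOpen hT.smooth hT.hol hu hJu).differentiableAt
      ((hT.isOpen.preimage hu.continuous).mem_nhds hz₀)
  -- its real differential is `dT ∘ du (z₀)`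
  have hTz : MDifferentiableAt (𝓡 4) 𝓘(ℝ, ℂ) T (u z₀) :=
    (hT.smooth.contMDiffAt (hT.isOpen.mem_nhds hz₀)).mdifferentiableAt (by simp)
  have huz : MDifferentiableAt 𝓘(ℝ, ℂ) (𝓡 4) u z₀ := hu.mdifferentiableAt (by simp)
  have hF : HasFDerivAt (T ∘ u)
      ((mfderiv (𝓡 4) 𝓘(ℝ, ℂ) T (u z₀)).comp (mfderiv 𝓘(ℝ, ℂ) (𝓡 4) u z₀) : ℂ →L[ℝ] ℂ) z₀ :=
    (hTz.hasMFDerivAt.comp z₀ huz.hasMFDerivAt).hasFDerivAt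
  -- compare with the complex derivative
  have hF' : HasFDerivAt (T ∘ u)
      ((ContinuousLinearMap.smulRight (1 : ℂ →L[ℂ] ℂ) (deriv (T ∘ u) z₀)).restrictScalars ℝ) z₀ :=
    hdiff.hasDerivAt.hasFDerivAt.restrictScalars ℝ
  have h : _ = mfderiv (𝓡 4) 𝓘(ℝ, ℂ) T (u z₀) (mfderiv 𝓘(ℝ, ℂ) (𝓡 4) u z₀ ζ) :=
    DFunLike.congr_fun (hF'.unique hF) ζ
  rw [hζ] at h
  simp only [ContinuousLinearMap.coe_restrictScalars', ContinuousLinearMap.smulRight_apply,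
    one_apply_eq_self, smul_eq_mul] at h
  exact (mul_eq_zero.mp h).resolve_right hd

/-! ### J16 -/

/-- **J16 (registered helper `helper_refMeetsHLeafOnce`): the reference sphere `V∞ = (u₀, v₀)`
meets every `H`-leaf in EXACTLY ONE point, TRANSVERSALLY.**  The `H`-leaf `(u', v')` meets the zero
set `{y ∈ UV | TV y = 0} = V∞` of the holomorphic wedge coordinate `TV` at exactly one parameter,
simply (`helper_leaf_meetsOnce` for the `H`-fibration data); `dTV` kills the vectors tangent to
`V∞` (`TV` vanishes along `u₀` and `v₀`, `refMeet_mfderiv_apply_eq_zero`) and is injective on the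
tangent line of the `H`-leaf at the simple meeting point (`refMeet_eq_zero_of_deriv_ne_zero`). -/
theorem helper_refMeetsHLeafOnce : ∀ (X : Type) [TopologicalSpace X] [T2Space X]
    [SecondCountableTopology X] [CompactSpace X] [ConnectedSpace X]
    [ChartedSpace (EuclideanSpace ℝ (Fin 4)) X] [IsManifold (𝓡 4) ∞ X] (ωX : MForm (𝓡 4) X ℝ 2)
    (JX : AlmostComplexStructure (𝓡 4) ∞ X) (u₀ v₀ uH vH : ℂ → X)
    (F₀ FH : C(ComplexProjectiveSpace 1, X)) (TH TV : X → ℂ) (UH UV : Set X) (δ : ℝ),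
    jSphere_wedgeCount_factorsThroughHomology →
    FoliationData ωX JX u₀ v₀ uH vH F₀ TH TV UH UV δ →
    FoliationData ωX JX uH vH u₀ v₀ FH TV TH UV UH δ →
    ∀ (u' v' : ℂ → X), IsLeafOf (fun y => JX y) FH u' v' →
    ∃ q : X, q ∈ pairImage u₀ v₀ ∧ q ∈ pairImage u' v' ∧
      (∀ q' : X, q' ∈ pairImage u₀ v₀ → q' ∈ pairImage u' v' → q' = q) ∧
      (∀ ξ : TangentSpace (𝓡 4) q,
        ((∃ z : ℂ, u₀ z = q ∧ ξ ∈ range (mfderiv 𝓘(ℝ, ℂ) (𝓡 4) u₀ z)) ∨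
          (v₀ 0 = q ∧ ξ ∈ range (mfderiv 𝓘(ℝ, ℂ) (𝓡 4) v₀ 0))) →
        ((∃ z' : ℂ, u' z' = q ∧ ξ ∈ range (mfderiv 𝓘(ℝ, ℂ) (𝓡 4) u' z')) ∨
          (v' 0 = q ∧ ξ ∈ range (mfderiv 𝓘(ℝ, ℂ) (𝓡 4) v' 0))) → ξ = 0) := by
  intro X _ _ _ _ _ _ _ ωX JX u₀ v₀ uH vH F₀ FH TH TV UH UV δ hF6 D D' u' v' hleaf'
  -- the zero set of `TV` on `UV` is `V∞`
  have hzs : ∀ y : X, (y ∈ UV ∧ TV y = 0) ↔ y ∈ pairImage u₀ v₀ := fun y =>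
    Set.ext_iff.mp D.zeroSetV y
  -- `TV` vanishes identically along both charts of `V∞`
  have hzu : ∀ w : ℂ, u₀ w ∈ UV ∧ TV (u₀ w) = 0 := fun w =>
    (hzs _).mpr ((mem_pairImage_iff u₀ v₀ _).mpr (Or.inl ⟨w, rfl⟩))
  have hzv : ∀ w : ℂ, v₀ w ∈ UV ∧ TV (v₀ w) = 0 := fun w => by
    refine (hzs _).mpr ((mem_pairImage_iff u₀ v₀ _).mpr ?_)
    by_cases hw : w = 0
    · subst hw
      exact Or.inr rfl
    · rw [D.ref_sphere.compat w hw]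
      exact Or.inl ⟨w⁻¹, rfl⟩
  -- STEP 1: `dTV` kills the vectors tangent to `V∞`
  have step1 : ∀ (q : X) (ξ : TangentSpace (𝓡 4) q),
      ((∃ z : ℂ, u₀ z = q ∧ ξ ∈ range (mfderiv 𝓘(ℝ, ℂ) (𝓡 4) u₀ z)) ∨
        (v₀ 0 = q ∧ ξ ∈ range (mfderiv 𝓘(ℝ, ℂ) (𝓡 4) v₀ 0))) →
      mfderiv (𝓡 4) 𝓘(ℝ, ℂ) TV q ξ = 0 := by
    rintro q ξ (⟨w, rfl, η, rfl⟩ | ⟨rfl, η, rfl⟩)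
    · exact refMeet_mfderiv_apply_eq_zero D.coordV.isOpen D.coordV.smooth D.ref_sphere.smooth_u
        hzu w η
    · exact refMeet_mfderiv_apply_eq_zero D.coordV.isOpen D.coordV.smooth D.ref_sphere.smooth_v
        hzv 0 η
  -- the `H`-leaf meets `V∞` at exactly one parameter, simply
  rcases helper_leaf_meetsOnce X ωX JX uH vH u₀ v₀ FH TV TH UV UH δ hF6 D' u' v' hleaf' with
    ⟨z₀, hz₀, huniq, hv0, hd⟩ | ⟨hnone, hv0, hd⟩
  · -- case A: the meeting point `q = u' z₀`
    refine ⟨u' z₀, (hzs _).mp hz₀, (mem_pairImage_iff u' v' _).mpr (Or.inl ⟨z₀, rfl⟩), ?_, ?_⟩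
    · -- uniqueness
      intro q' h0 h'
      rcases (mem_pairImage_iff u' v' q').mp h' with ⟨z, rfl⟩ | rfl
      · rw [huniq z ((hzs _).mpr h0)]
      · exact (hv0 ((hzs _).mpr h0)).elim
    · -- transversality
      intro ξ hV hH
      have h1 : mfderiv (𝓡 4) 𝓘(ℝ, ℂ) TV (u' z₀) ξ = 0 := step1 (u' z₀) ξ hV
      rcases hH with ⟨z', hz', ζ, rfl⟩ | ⟨hv, -⟩
      · obtain rfl : z' = z₀ := hleaf'.embedded.injective hz'
        have hζ : ζ = 0 := refMeet_eq_zero_of_deriv_ne_zero D.coordV hleaf'.sphere.smooth_u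
          hleaf'.sphere.hol_u hz₀.1 hd h1
        rw [hζ, map_zero]
      · exact (hleaf'.embedded.infty_notMem ⟨z₀, hv.symm⟩).elim
  · -- case B: the meeting point `q = v' 0`
    refine ⟨v' 0, (hzs _).mp hv0, (mem_pairImage_iff u' v' _).mpr (Or.inr rfl), ?_, ?_⟩
    · -- uniqueness
      intro q' h0 h'
      rcases (mem_pairImage_iff u' v' q').mp h' with ⟨z, rfl⟩ | rfl
      · exact (hnone z ((hzs _).mpr h0)).elim
      · rfl
    · -- transversality
      intro ξ hV hH
      have h1 : mfderiv (𝓡 4) 𝓘(ℝ, ℂ) TV (v' 0) ξ = 0 := step1 (v' 0) ξ hV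
      rcases hH with ⟨z', hz', -⟩ | ⟨-, ζ, rfl⟩
      · exact (hleaf'.embedded.infty_notMem ⟨z', hz'⟩).elim
      · have hζ : ζ = 0 := refMeet_eq_zero_of_deriv_ne_zero D.coordV hleaf'.sphere.smooth_v
          hleaf'.sphere.hol_v hv0.1 hd h1
        rw [hζ, map_zero]

end Summit.SmoothPoincare4.SmoothPoincare4.Theorems.GromovRecognitionRelEnd.CrossCapLaurent

end
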